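import Summits.RiemannHypothesis.RiemannHypothesis.Theorems.WeilColumnThetaTopLayer
import Summits.RiemannHypothesis.RiemannHypothesis.Theorems.WeilColumnThetaCutWitness
import Summits.RiemannHypothesis.RiemannHypothesis.Theorems.WeilColumnThetaAtom
import HarnessLib

/-!
# THETA kernel certificate, D4 for THE WITNESS: the one-atom inequality `(log q/√q)·Re(k(log q) + k(−log q)) ≤ −2 log q·I + atom` (RH-FREE)

Cell `rh-explicit`, WEIL column, seat weil-1 gen19 (THETA-ASSIGN v1.0/1.1 §3 item D4; THETA-CERT-cc6 §D4). handoff-prove-2's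
`WeilColumnThetaAtom` (p427308) proves the one-atom decomposition ABSTRACTLY, for any continuous real `g` vanishing off `[−a, a]`,
under three hypotheses: the top-layer form `g(a − w) = e^{(a−w)/2}ρ(w)` on `[0, 2δ]` and sup bounds `S_top`, `S_bot` on the two
layers. This file DISCHARGES them for the witness `g = P.g` of an admissible row (`2 ≤ q`) and states the result in the interface's
names:

* §1 the layers: `‖Θ(e^v)‖ ≤ M_L` and `‖g(v)‖ ≤ e^{v/2}·M_L·χ_L` for `v ≤ 2δ − a` (D1 + the monotone cut), `0 ≤ Rtop ≤ 1`,
  `‖g(x)‖ ≤ e^{x/2}` for `x ≥ a − 2δ` (top-layer form of `WeilColumnThetaTopLayer`);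
* §2 `atom_norm_sub_le`: **`‖k(log q) + k(−log q) + 2√q·I‖ ≤ 8δ·e^{a/2}·S_bot + 4δ·S_bot²`**, `S_bot = e^{(2δ−a)/2}M_Lχ_L`
  (`k = g⁻ ⋆ g̃⁻`, `I = P.Itop`; instance of `ThetaAtom.norm_atom_sub_le` with `ρ = Rtop ∘ τ₁`, `S_top = e^{a/2}`);
* §3 **`atom_re_le`: `(log q/√q)·Re(k(log q) + k(−log q)) ≤ −2 log q·P.Itop + P.atom`** (`e^{2δ−a} = e^δ/√q`, `h_max ≥ 1`)
  — the checker's `atom` let as a real inequality for the un-mollified witness;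
* §4 the window facts FIN needs: `a < (log q⁺)/2`, hence eventually `tsupport φ_k ⊆ [−(log q⁺)/2, (log q⁺)/2]`.

The mollified witness `φ_k` and the atom side of FIN follow in `WeilColumnThetaAtomMollified`.
(File renamed from the announced «ThetaAtomWitness» to avoid a path twin with handoff-prove-2's glue file of that name.)
Upper-clause bookkeeping only; nothing here bears on the truth of RH.
-/

noncomputable section

set_option linter.dupNamespace false

open Complex Set MeasureTheory Filter
open scoped Real Topology ComplexConjugate

namespace Summit.RiemannHypothesis.RiemannHypothesis.Theorems.WeilColumn.ThetaMellin

open Literature.NumberTheory.LFunctions ThetaParams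

namespace ThetaParams

variable {P : ThetaParams}

/-! ## §1 Pointwise bounds on the two layers -/

/-- `1 ≤ m` for an admissible row. -/
private theorem one_le_m'' {qn : ℕ} (hP : P.Admissible qn) : 1 ≤ P.m := le_trans (by norm_num) hP.three_le

/-- `0 ≤ M`. -/
private theorem M_nonneg_aux {qn : ℕ} (hP : P.Admissible qn) : 0 ≤ P.M := by
  have h := le_trans (norm_nonneg _) (P.norm_Θ_le' hP Real.zero_lt_one)
  have hc : 0 < (1 / P.u₁) ^ P.m := by have : 0 < P.u₁ := Real.exp_pos _; positivity
  exact le_of_mul_le_mul_right (by rwa [zero_mul]) hc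

/-- `0 ≤ M_L`. -/
private theorem ML_nonneg_aux {qn : ℕ} (hP : P.Admissible qn) : 0 ≤ P.ML := by
  unfold ML; exact mul_nonneg (M_nonneg_aux hP) (Real.exp_pos _).le

/-- `0 ≤ χ_L`. -/
private theorem chiL_nonneg_aux {qn : ℕ} (hP : P.Admissible qn) : 0 ≤ P.chiL :=
  (P.cut_mem_Icc hP.eta_pos (one_le_m'' hP) _).1

/-- **D1 on the bottom layer**: `‖Θ(e^v)‖ ≤ M_L = M·e^{m(2δ−η)}` for `v ≤ 2δ − a`. [THETA-CERT-cc6 §D4] -/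
theorem norm_Θ_exp_le_ML {qn : ℕ} (hP : P.Admissible qn) {v : ℝ} (hv : v ≤ 2 * P.δ - P.a) :
    ‖P.Θ (Real.exp v)‖ ≤ P.ML := by
  have h := P.norm_Θ_le' hP (Real.exp_pos v)
  refine h.trans ?_
  unfold ML
  refine mul_le_mul_of_nonneg_left ?_ (M_nonneg_aux hP)
  have e : Real.exp v / P.u₁ = Real.exp (v - P.x₁) := by unfold u₁; rw [Real.exp_sub]
  rw [e, ← Real.exp_nat_mul]
  refine Real.exp_le_exp.2 ?_
  have hx : v - P.x₁ ≤ 2 * P.δ - P.η := by unfold x₁; linarith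
  exact mul_le_mul_of_nonneg_left hx (Nat.cast_nonneg _)

/-- **The bottom layer of `g`**: `‖g(v)‖ ≤ e^{v/2}·M_L·χ_L` for `v ≤ 2δ − a` (`χ` monotone, `χ_L = χ(2δ − a)`). [THETA-CERT-cc6 §D4] -/
theorem norm_g_bottom_le {qn : ℕ} (hP : P.Admissible qn) {v : ℝ} (hv : v ≤ 2 * P.δ - P.a) :
    ‖P.g v‖ ≤ Real.exp (v / 2) * P.ML * P.chiL := by
  have hm := one_le_m'' hP
  have hχ := P.cut_mem_Icc hP.eta_pos hm v
  have hχL : P.cut v ≤ P.chiL := P.cut_mono hP.eta_pos hm hv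
  rw [g, norm_mul, Complex.norm_real, Real.norm_of_nonneg hχ.1]
  have hG₀ : ‖P.G₀ v‖ ≤ Real.exp (v / 2) * P.ML := by
    show ‖expProfile P.Θ v‖ ≤ _
    rw [expProfile, norm_mul, Complex.norm_real, Real.norm_of_nonneg (Real.exp_pos _).le]
    exact mul_le_mul_of_nonneg_left (norm_Θ_exp_le_ML hP hv) (Real.exp_pos _).le
  exact mul_le_mul hG₀ hχL hχ.1 (by have := ML_nonneg_aux hP; positivity)

/-- `0 ≤ Rtop τ ≤ 1`. [folklore] -/
theorem Rtop_mem_Icc {qn : ℕ} (hP : P.Admissible qn) (τ : ℝ) : P.Rtop τ ∈ Icc (0 : ℝ) 1 := by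
  have hm0 : (0 : ℝ) < P.m := Nat.cast_pos.2 (by have := one_le_m'' hP; omega)
  have hc : 0 < 1 / (P.m : ℝ) := by positivity
  unfold Rtop
  exact ⟨by linarith [bsplineCDF_le_one hc (P.m - 1) (1 - τ)], by linarith [bsplineCDF_nonneg hc.le (P.m - 1) (1 - τ)]⟩

/-- **The top layer of `g` in norm**: `‖g(x)‖ ≤ e^{x/2}` for `x ≥ a − 2δ` (`|Rtop| ≤ 1`, `|χ| ≤ 1`). [THETA-CERT-cc6 §D4] -/
theorem norm_g_top_le {qn : ℕ} (hP : P.Admissible qn) {x : ℝ} (hx : P.a - 2 * P.δ ≤ x) : ‖P.g x‖ ≤ Real.exp (x / 2) := by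
  have hχ := P.cut_mem_Icc hP.eta_pos (one_le_m'' hP) x
  have hR := Rtop_mem_Icc hP (P.τ₁ (P.a - x))
  rw [g, G₀_top hP hx, norm_mul, norm_mul, Complex.norm_real, Complex.norm_real, Complex.norm_real,
    Real.norm_of_nonneg (Real.exp_pos _).le, Real.norm_of_nonneg hR.1, Real.norm_of_nonneg hχ.1]
  calc Real.exp (x / 2) * P.Rtop (P.τ₁ (P.a - x)) * P.cut x ≤ Real.exp (x / 2) * 1 * 1 :=
        mul_le_mul (mul_le_mul_of_nonneg_left hR.2 (Real.exp_pos _).le) hχ.2 hχ.1 (by positivity)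
    _ = Real.exp (x / 2) := by ring

/-! ## §2 The abstract decomposition instantiated: `‖k(log q) + k(−log q) + 2√q·I‖ ≤ 8δ·e^{a/2}·S_bot + 4δ·S_bot²` -/

/-- **The one-atom decomposition for the witness** (instance of `ThetaAtom.norm_atom_sub_le` with `ρ = Rtop ∘ τ₁`,
`S_top = e^{a/2}`, `S_bot = e^{(2δ−a)/2}·M_L·χ_L`): `‖k(log q) + k(−log q) + 2√q·I‖ ≤ 8δ·e^{a/2}·S_bot + 4δ·S_bot²`. [THETA-CERT-cc6 §D4] -/
theorem atom_norm_sub_le {qn : ℕ} (hP : P.Admissible qn) (hq : 2 ≤ P.q) :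
    ‖weilConv P.gOdd (weilReflect P.gOdd) (Real.log P.q) + weilConv P.gOdd (weilReflect P.gOdd) (-Real.log P.q) +
        2 * ((Real.sqrt P.q * P.Itop : ℝ) : ℂ)‖ ≤
      8 * P.δ * Real.exp (P.a / 2) * (Real.exp ((2 * P.δ - P.a) / 2) * P.ML * P.chiL) +
        4 * P.δ * (Real.exp ((2 * P.δ - P.a) / 2) * P.ML * P.chiL) ^ 2 := by
  have hδ := hP.delta_pos
  have hq0 : (0 : ℝ) < P.q := by exact_mod_cast (lt_of_lt_of_le (by norm_num) hq)
  have hML := ML_nonneg_aux hP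
  have hχ := chiL_nonneg_aux hP
  have htop : ∀ w ∈ Icc (0 : ℝ) (2 * P.δ),
      P.g (P.a - w) = ((Real.exp ((P.a - w) / 2) * (fun w ↦ P.Rtop (P.τ₁ w)) w : ℝ) : ℂ) := by
    intro w hw
    rw [g_top hP hq (by linarith [hw.2])]
    simp only [sub_sub_cancel]
  have hStop : ∀ x ∈ Icc (P.a - 2 * P.δ) P.a, ‖P.g x‖ ≤ Real.exp (P.a / 2) := fun x hx ↦
    (norm_g_top_le hP hx.1).trans (Real.exp_le_exp.2 (by linarith [hx.2]))
  have hSbot : ∀ x ∈ Icc (-P.a) (-P.a + 2 * P.δ), ‖P.g x‖ ≤ Real.exp ((2 * P.δ - P.a) / 2) * P.ML * P.chiL := by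
    intro x hx
    refine (norm_g_bottom_le hP (by linarith [hx.2])).trans ?_
    have : Real.exp (x / 2) ≤ Real.exp ((2 * P.δ - P.a) / 2) := Real.exp_le_exp.2 (by linarith [hx.2])
    gcongr
  have h := ThetaAtom.norm_atom_sub_le (g := P.g) (a := P.a) hδ (continuous_g hP) P.conj_g
    (fun x hx ↦ g_eq_zero_of_le hP hx.le) (fun x hx ↦ g_eq_zero_of_lt hP hx) htop (Real.exp_pos _).le
    (by positivity) hStop hSbot
  -- `2a − 2δ = log q`, `e^{(log q)/2} = √q`, and the integral is `Itop`; `fun u ↦ g u − g(−u)` is `gOdd`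
  have hgOdd : (fun u ↦ P.g u - P.g (-u)) = P.gOdd := rfl
  rw [hgOdd, ← log_q_eq P, Real.exp_half, Real.exp_log hq0] at h
  exact h

/-! ## §3 The one-atom inequality in the checker's currency -/

/-- `e^{(2δ − a)/2}·e^{(2δ − a)/2} = e^δ/√q` (as `a = (log q)/2 + δ`). [folklore] -/
theorem exp_bottom_sq (hq : 1 ≤ P.q) :
    Real.exp ((2 * P.δ - P.a) / 2) * Real.exp ((2 * P.δ - P.a) / 2) = Real.exp P.δ / Real.sqrt P.q := by
  have hq0 : (0 : ℝ) < P.q := by exact_mod_cast hq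
  rw [← Real.exp_add, show (2 * P.δ - P.a) / 2 + (2 * P.δ - P.a) / 2 = P.δ - Real.log P.q / 2 by unfold a; ring,
    Real.exp_sub, Real.exp_half, Real.exp_log hq0]

/-- `e^{a/2}·e^{(2δ − a)/2} = e^δ`. [folklore] -/
theorem exp_top_mul_bottom (P : ThetaParams) : Real.exp (P.a / 2) * Real.exp ((2 * P.δ - P.a) / 2) = Real.exp P.δ := by
  rw [← Real.exp_add]; congr 1; ring

/-- **THE ONE-ATOM INEQUALITY (D4) for the witness**: `(log q/√q)·Re(k(log q) + k(−log q)) ≤ −2 log q·I + atom`, where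
`atom = (2 log q/√q)·r̄`, `r̄ = 4δe^δ·h_max·M_L·χ_L + 2δ(e^δ/√q)·M_L²χ_L²`. [THETA-CERT-cc6 §D4] -/
theorem atom_re_le {qn : ℕ} (hP : P.Admissible qn) (hq : 2 ≤ P.q) :
    Real.log P.q / Real.sqrt P.q *
        (weilConv P.gOdd (weilReflect P.gOdd) (Real.log P.q) + weilConv P.gOdd (weilReflect P.gOdd) (-Real.log P.q)).re ≤
      -2 * Real.log P.q * P.Itop + P.atom := by
  have hq1 : 1 ≤ P.q := le_trans (by norm_num) hq
  have hq1' : (1 : ℝ) ≤ P.q := by exact_mod_cast hq1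
  have hq0 : (0 : ℝ) < P.q := by linarith
  have hlog : 0 ≤ Real.log P.q := Real.log_nonneg hq1'
  have hsq : 0 < Real.sqrt P.q := Real.sqrt_pos.2 hq0
  have hw : 0 ≤ Real.log P.q / Real.sqrt P.q := div_nonneg hlog hsq.le
  have hδ := hP.delta_pos
  have hML := ML_nonneg_aux hP
  have hχ := chiL_nonneg_aux hP
  have hmax : 1 ≤ P.hmax := le_max_left _ _
  set z := weilConv P.gOdd (weilReflect P.gOdd) (Real.log P.q) + weilConv P.gOdd (weilReflect P.gOdd) (-Real.log P.q) with hz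
  set Sb := Real.exp ((2 * P.δ - P.a) / 2) * P.ML * P.chiL with hSb
  have hnorm := atom_norm_sub_le hP hq
  rw [← hz, ← hSb] at hnorm
  -- real part of `z + 2√q·I` is bounded by the norm
  have hre : z.re + 2 * (Real.sqrt P.q * P.Itop) ≤ 8 * P.δ * Real.exp (P.a / 2) * Sb + 4 * P.δ * Sb ^ 2 := by
    have h1 := (Complex.re_le_norm (z + 2 * ((Real.sqrt P.q * P.Itop : ℝ) : ℂ))).trans hnorm
    have h2 : (z + 2 * ((Real.sqrt P.q * P.Itop : ℝ) : ℂ)).re = z.re + 2 * (Real.sqrt P.q * P.Itop) := by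
      simp [Complex.add_re, Complex.mul_re]
    linarith
  -- the remainder in the checker's currency: `8δe^{a/2}S_bot + 4δS_bot² ≤ 2·r̄`
  have hR : 8 * P.δ * Real.exp (P.a / 2) * Sb + 4 * P.δ * Sb ^ 2 ≤ 2 * P.rbar := by
    have e1 : 8 * P.δ * Real.exp (P.a / 2) * Sb = 8 * P.δ * Real.exp P.δ * P.ML * P.chiL := by
      rw [hSb, ← exp_top_mul_bottom P]; ring
    have e2 : 4 * P.δ * Sb ^ 2 = 4 * P.δ * (Real.exp P.δ / Real.sqrt P.q) * P.ML ^ 2 * P.chiL ^ 2 := by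
      rw [hSb, ← exp_bottom_sq (P := P) hq1]; ring
    rw [e1, e2]
    unfold rbar
    have t1 : 8 * P.δ * Real.exp P.δ * P.ML * P.chiL ≤ 2 * (4 * P.δ * Real.exp P.δ * P.hmax * P.ML * P.chiL) := by
      have e : 2 * (4 * P.δ * Real.exp P.δ * P.hmax * P.ML * P.chiL) = P.hmax * (8 * P.δ * Real.exp P.δ * P.ML * P.chiL) := by
        ring
      rw [e]
      exact le_mul_of_one_le_left (by positivity) hmax
    nlinarith [t1]
  -- multiply by `log q/√q ≥ 0`; `(log q/√q)·2√q·I = 2 log q·I`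
  have hmain : Real.log P.q / Real.sqrt P.q * (2 * (Real.sqrt P.q * P.Itop)) = 2 * Real.log P.q * P.Itop := by
    field_simp
  have h3 : Real.log P.q / Real.sqrt P.q * z.re ≤
      Real.log P.q / Real.sqrt P.q * (2 * P.rbar - 2 * (Real.sqrt P.q * P.Itop)) :=
    mul_le_mul_of_nonneg_left (by linarith) hw
  have e : Real.log P.q / Real.sqrt P.q * (2 * P.rbar - 2 * (Real.sqrt P.q * P.Itop)) =
      P.atom - Real.log P.q / Real.sqrt P.q * (2 * (Real.sqrt P.q * P.Itop)) := by
    unfold atom; ring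
  rw [e, hmain] at h3
  linarith

/-! ## §4 The window facts FIN needs -/

/-- **The witness window sits strictly inside the next window**: `a < (log q⁺)/2` (`e^{2δ}q < q⁺`, `q ≥ 1`). [folklore] -/
theorem a_lt_log_half {qn : ℕ} (hP : P.Admissible qn) (hq : 1 ≤ P.q) : P.a < Real.log qn / 2 := by
  have hq0 : (0 : ℝ) < P.q := by exact_mod_cast hq
  have hw := hP.window
  have hpos : 0 < Real.exp (2 * P.δ) * P.q := by positivity
  have h := Real.log_lt_log hpos hw
  rw [Real.log_mul (Real.exp_pos _).ne' hq0.ne', Real.log_exp] at h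
  unfold a; linarith

/-- Hence, eventually in `k`, the mollified witness `φ_k` is supported in the next window `[−(log q⁺)/2, (log q⁺)/2]`. [folklore] -/
theorem eventually_tsupport_phi_subset_window {qn : ℕ} (hP : P.Admissible qn) (hq : 1 ≤ P.q) :
    ∀ᶠ k : ℕ in atTop, tsupport (P.phi k) ⊆ Icc (-(Real.log qn / 2)) (Real.log qn / 2) :=
  eventually_tsupport_phi_subset hP (a_lt_log_half hP hq)

end ThetaParams

end Summit.RiemannHypothesis.RiemannHypothesis.Theorems.WeilColumn.ThetaMellin

end
-- build re-dispatch marker (comment-only re-land, 2026-08-26; no declaration changed)
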